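import Mathlib
import Summits.ValiantsHypothesis.ValiantsHypothesis.Theorems.TriangularDimersDivisionEasy.Negative.Matcher

/-!
# `TriangularDimersDivisionEasy` — negative-side toolkit 2: the flexible gadget (radius-3 edge ball)

Crux `stmt-ValiantsHypothesis-5067` (`Theses.DivisionGap.TriangularDimersDivisionEasy`, route
DivisionGap).  Standing disprover (cdisprove gen 1); the computational heart of the load-bearing
lemma `false_without_division` (Valiant 1980, Thm 1, for the rhombus).

THE GADGET.  The 44 vertices of the triangular lattice `ℤ²` (directions `(±1,0)`, `(0,±1)`,
`±(1,-1)` — the crux's six disjuncts) within graph distance `3` of the edge `e = {(0,0),(1,0)}`,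
indexed `0 … 43` in lexicographic order (`coordL`); `bdryI` = the 20 of them having a lattice
neighbour outside; `qI` = the unit rhombus `{(0,0),(1,0),(0,1),(-1,1)}` through `e` (indices
`18, 25, 19, 12`; a 4-cycle `18–12–19–25–18`).  Adjacency is tabulated as neighbour bitmasks
(`nbrL`, `adjI`) and certified against the lattice (`adjI_spec`).

THE FACT (`gadget_all₀…₃`, by `native_decide`, `2^20` boundary subsets in four slices; found and
cross-checked by the seat's toy search, 22·10⁶ DFS nodes in all): for EVERY `S ⊆ bdryI` of even size,
the graph induced on `ball ∖ S ∖ Q` has a perfect matching (`gadget_pm`).  Hence, whatever the outside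
of a placed copy of the ball does (it can only delete a boundary subset `S`), the inside has a perfect
matching through the centre edge AND one avoiding it — the centre edge is never frozen.  (The radius-1
and radius-2 balls fail this: 74 resp. 126 bad boundary subsets.)
[folklore]
-/

namespace Summit.ValiantsHypothesis.ValiantsHypothesis.Theorems.TriangularDimersDivisionEasy.Negative

set_option linter.dupNamespace false

/-! ## Lattice adjacency on `ℤ²` -/

/-- The six lattice directions of the triangular lattice on `ℤ²` (the crux's six disjuncts). [folklore] -/
def dirs : List (ℤ × ℤ) := [(1, 0), (-1, 0), (0, 1), (0, -1), (1, -1), (-1, 1)]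

/-- Adjacency of the triangular lattice on `ℤ²`. [folklore] -/
def adjZ (p q : ℤ × ℤ) : Bool := dirs.contains (q.1 - p.1, q.2 - p.2)

/-- The lattice adjacency spelled out as the six coordinate relations. [folklore] -/
theorem adjZ_iff (p q : ℤ × ℤ) : adjZ p q = true ↔
    (q.1 = p.1 + 1 ∧ q.2 = p.2) ∨ (q.1 + 1 = p.1 ∧ q.2 = p.2) ∨ (q.1 = p.1 ∧ q.2 = p.2 + 1) ∨
    (q.1 = p.1 ∧ q.2 + 1 = p.2) ∨ (q.1 = p.1 + 1 ∧ q.2 + 1 = p.2) ∨ (q.1 + 1 = p.1 ∧ q.2 = p.2 + 1) := by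
  simp only [adjZ, dirs, List.contains_iff_mem, List.mem_cons, Prod.mk.injEq, List.not_mem_nil,
    or_false]
  omega

/-- The lattice adjacency is symmetric. [folklore] -/
theorem adjZ_symm (p q : ℤ × ℤ) : adjZ p q = adjZ q p := by
  rw [Bool.eq_iff_iff, adjZ_iff, adjZ_iff]
  omega

/-! ## The ball, tabulated -/

/-- Coordinates of the 44 ball vertices (lexicographic). [folklore] -/
def coordL : List (ℤ × ℤ) :=
  [(-3, 0), (-3, 1), (-3, 2), (-3, 3), (-2, -1), (-2, 0), (-2, 1), (-2, 2), (-2, 3), (-1, -2), (-1, -1),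
   (-1, 0), (-1, 1), (-1, 2), (-1, 3), (0, -3), (0, -2), (0, -1), (0, 0), (0, 1), (0, 2), (0, 3), (1, -3),
   (1, -2), (1, -1), (1, 0), (1, 1), (1, 2), (1, 3), (2, -3), (2, -2), (2, -1), (2, 0), (2, 1), (2, 2),
   (3, -3), (3, -2), (3, -1), (3, 0), (3, 1), (4, -3), (4, -2), (4, -1), (4, 0)]

/-- Coordinate of ball vertex `i` (junk `(0,0)` for `i ≥ 44`). [folklore] -/
def coord (i : ℕ) : ℤ × ℤ := coordL.getD i (0, 0)

/-- Neighbour bitmasks: bit `j` of `nbrL[i]` is set iff ball vertices `i` and `j` are lattice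
neighbours. [folklore] -/
def nbrL : List ℕ :=
  [50, 101, 202, 388, 1569, 3155, 6310, 12620, 24712, 99344, 199216, 398432, 796864, 1593728, 3154176,
   4260352, 12748288, 25496576, 50993152, 101986304, 203972608, 403718144, 545357824, 1631780864,
   3263561728, 6527123456, 13054246912, 26108493824, 17316184064, 35446063104, 105788735488,
   211577470976, 423154941952, 846309883904, 558748401664, 1169841717248, 3473554800640,
   6947109601280, 13894219202560, 9096740732928, 2302102470656, 5703716569088, 11407433138176,
   5222680231936]

/-- The same table as an array (constant-time lookup in the search). [folklore] -/
def nbrA : Array ℕ := nbrL.toArray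

/-- Tabulated adjacency of the ball (indices `≥ 44` are adjacent to nothing). [folklore] -/
def adjI (i j : ℕ) : Bool := (nbrA.getD i 0).testBit j

/-- Boundary vertices (those with a lattice neighbour outside the ball). [folklore] -/
def bdryI : List ℕ := [0, 1, 2, 3, 4, 8, 9, 14, 15, 21, 22, 28, 29, 34, 35, 39, 40, 41, 42, 43]

/-- The unit rhombus through the centre edge `{18, 25} = {(0,0), (1,0)}`: `(0,0), (1,0), (0,1), (-1,1)`.
[folklore] -/
def qI : List ℕ := [18, 25, 19, 12]

/-- The ball minus the rhombus. [folklore] -/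
def ballMinusQ : List ℕ := (List.range 44).filter fun i => !(qI.contains i)

/-- The check for one boundary subset `S` (a sublist of `bdryI`): `|S|` odd (then `ball ∖ S` is odd), or
the verified search finds a perfect matching of `ball ∖ S ∖ Q`. [folklore] -/
def gadgetCheck (S : List ℕ) : Bool :=
  S.length % 2 == 1 || hasPM adjI (ballMinusQ.filter fun i => !(S.contains i))

/-! ## The computation (four slices of the `2^20` boundary subsets, by the first two boundary vertices) -/

/-- The gadget check on all boundary subsets avoiding the first two boundary vertices (computational). [folklore] -/
theorem gadget_all₀ : ((bdryI.drop 2).sublists.all fun S => gadgetCheck S) = true := by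
  native_decide

/-- The gadget check on all boundary subsets containing boundary vertex `0` but not `1` (computational). [folklore] -/
theorem gadget_all₁ : ((bdryI.drop 2).sublists.all fun S => gadgetCheck (0 :: S)) = true := by
  native_decide

/-- The gadget check on all boundary subsets containing boundary vertex `1` but not `0` (computational). [folklore] -/
theorem gadget_all₂ : ((bdryI.drop 2).sublists.all fun S => gadgetCheck (1 :: S)) = true := by
  native_decide

/-- The gadget check on all boundary subsets containing boundary vertices `0` and `1` (computational). [folklore] -/
theorem gadget_all₃ : ((bdryI.drop 2).sublists.all fun S => gadgetCheck (0 :: 1 :: S)) = true := by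
  native_decide

/-- All sublists of `bdryI` pass the check. [folklore] -/
theorem gadgetCheck_of_sublist {S : List ℕ} (hS : S.Sublist bdryI) : gadgetCheck S = true := by
  have hb : bdryI = [0, 1] ++ bdryI.drop 2 := by decide
  rw [hb] at hS
  obtain ⟨l₁, l₂, rfl, h₁, h₂⟩ := List.sublist_append_iff.1 hS
  have hm : l₂ ∈ (bdryI.drop 2).sublists := List.mem_sublists.2 h₂
  have h01 : l₁ ∈ ([0, 1] : List ℕ).sublists := List.mem_sublists.2 h₁
  have hsubs : ([0, 1] : List ℕ).sublists = [[], [0], [1], [0, 1]] := by decide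
  rw [hsubs] at h01
  simp only [List.mem_cons, List.not_mem_nil, or_false] at h01
  rcases h01 with rfl | rfl | rfl | rfl
  · simpa using List.all_eq_true.1 gadget_all₀ l₂ hm
  · simpa using List.all_eq_true.1 gadget_all₁ l₂ hm
  · simpa using List.all_eq_true.1 gadget_all₂ l₂ hm
  · simpa using List.all_eq_true.1 gadget_all₃ l₂ hm

/-! ## Certification of the tables -/

/-- The ball has 44 vertices. [folklore] -/
theorem coordL_length : coordL.length = 44 := by decide
/-- One neighbour mask per ball vertex. [folklore] -/
theorem nbrL_length : nbrL.length = 44 := by decide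
/-- The coordinate table has no repetition. [folklore] -/
theorem coordL_nodup : coordL.Nodup := by decide
/-- The boundary list has no repetition. [folklore] -/
theorem bdryI_nodup : bdryI.Nodup := by decide

/-- Neighbour masks only use the 44 ball bits. [folklore] -/
theorem nbrL_lt : ∀ m ∈ nbrL, m < 2 ^ 44 := by decide

/-- Indices outside the ball are adjacent to nothing. [folklore] -/
theorem adjI_eq_false_of_le {i j : ℕ} (h : 44 ≤ i ∨ 44 ≤ j) : adjI i j = false := by
  unfold adjI nbrA
  rcases h with h | h
  · rw [Array.getD_eq_getD_getElem?, List.getElem?_toArray, List.getElem?_eq_none (by rw [nbrL_length]; exact h)]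
    simp
  · rw [Array.getD_eq_getD_getElem?, List.getElem?_toArray]
    cases hm : nbrL[i]? with
    | none => simp
    | some m =>
      have hmem : m ∈ nbrL := List.mem_of_getElem? hm
      simp only [Option.getD_some]
      exact Nat.testBit_eq_false_of_lt (lt_of_lt_of_le (nbrL_lt m hmem) (Nat.pow_le_pow_right (by norm_num) h))

/-- Adjacent indices are ball indices. [folklore] -/
theorem adjI_lt {i j : ℕ} (h : adjI i j = true) : i < 44 ∧ j < 44 := by
  by_contra hc
  rw [not_and_or, not_lt, not_lt] at hc
  rw [adjI_eq_false_of_le hc] at h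
  exact Bool.false_ne_true h

/-- The table is the lattice adjacency of the coordinates (finite check). [folklore] -/
theorem adjI_spec_fin : ∀ i ∈ List.range 44, ∀ j ∈ List.range 44,
    adjI i j = adjZ (coord i) (coord j) := by
  decide

/-- The tabulated adjacency is the lattice adjacency of the coordinates. [folklore] -/
theorem adjI_spec {i j : ℕ} (hi : i < 44) (hj : j < 44) : adjI i j = adjZ (coord i) (coord j) :=
  adjI_spec_fin i (List.mem_range.2 hi) j (List.mem_range.2 hj)

/-- The tabulated adjacency is symmetric. [folklore] -/
theorem adjI_symm (i j : ℕ) : adjI i j = adjI j i := by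
  by_cases h : i < 44 ∧ j < 44
  · rw [adjI_spec h.1 h.2, adjI_spec h.2 h.1, adjZ_symm]
  · rw [not_and_or, not_lt, not_lt] at h
    rw [adjI_eq_false_of_le h, adjI_eq_false_of_le (h.symm)]

/-- Boundary indices are ball indices. [folklore] -/
theorem mem_bdryI_lt : ∀ i ∈ bdryI, i < 44 := by decide
/-- Rhombus indices are ball indices. [folklore] -/
theorem mem_qI_lt : ∀ i ∈ qI, i < 44 := by decide
/-- The rhombus is interior (not boundary). [folklore] -/
theorem qI_not_mem_bdryI : ∀ i ∈ qI, i ∉ bdryI := by decide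

/-- The rhombus is the 4-cycle `18 – 12 – 19 – 25 – 18` (`(0,0)–(-1,1)–(0,1)–(1,0)`). [folklore] -/
theorem rhombus_cycle : adjI 18 12 = true ∧ adjI 12 19 = true ∧ adjI 19 25 = true ∧ adjI 25 18 = true := by
  decide

/-- Index of the lattice neighbour of ball vertex `i` in direction `d` (`44` if it is outside). [folklore] -/
def stepI (i : ℕ) (d : ℤ × ℤ) : ℕ := coordL.findIdx fun q => q == ((coord i).1 + d.1, (coord i).2 + d.2)

/-- Interior vertices have all six lattice neighbours inside the ball. [folklore] -/
theorem stepI_lt_of_not_mem_bdryI : ∀ i ∈ List.range 44, i ∉ bdryI → ∀ d ∈ dirs, stepI i d < 44 := by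
  decide

/-- `stepI` finds the neighbour (finite check). [folklore] -/
theorem coord_stepI_fin : ∀ i ∈ List.range 44, ∀ d ∈ dirs, stepI i d < 44 →
    coord (stepI i d) = ((coord i).1 + d.1, (coord i).2 + d.2) := by
  decide

/-- `stepI` finds the lattice neighbour of an interior direction step. [folklore] -/
theorem coord_stepI {i : ℕ} (hi : i < 44) {d : ℤ × ℤ} (hd : d ∈ dirs) (h : stepI i d < 44) :
    coord (stepI i d) = ((coord i).1 + d.1, (coord i).2 + d.2) :=
  coord_stepI_fin i (List.mem_range.2 hi) d hd h

/-! ## The gadget lemma, mathematical form -/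

/-- **The gadget lemma.**  For every duplicate-free even set `S` of boundary vertices, the graph
induced on `ball ∖ Q ∖ S` has a perfect matching. [folklore] -/
theorem gadget_pm (S : List ℕ) (hS : ∀ i ∈ S, i ∈ bdryI) (hnd : S.Nodup) (heven : Even S.length) :
    ∃ g, IsPMOn adjI (ballMinusQ.filter fun i => !(S.contains i)) g := by
  classical
  set S' := bdryI.filter fun p => S.contains p with hS'
  have hsub : S'.Sublist bdryI := List.filter_sublist
  have hperm : S'.Perm S := by
    rw [List.perm_ext_iff_of_nodup (bdryI_nodup.filter _) hnd]
    intro a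
    simp only [List.mem_filter, List.contains_iff_mem]
    exact ⟨fun h => h.2, fun h => ⟨hS a h, h⟩⟩
  have hcheck := gadgetCheck_of_sublist hsub
  have hfilt : (ballMinusQ.filter fun i => !(S'.contains i)) = ballMinusQ.filter fun i => !(S.contains i) := by
    apply List.filter_congr
    intro p _
    have hc : S'.contains p = S.contains p := by
      rw [Bool.eq_iff_iff, List.contains_iff_mem, List.contains_iff_mem]; exact hperm.mem_iff
    rw [hc]
  simp only [gadgetCheck, hfilt, Bool.or_eq_true, beq_iff_eq, hperm.length_eq] at hcheck
  rcases hcheck with hodd | hpm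
  · exfalso
    obtain ⟨k, hk⟩ := heven
    omega
  · refine (hasPM_iff adjI adjI_symm ?_).1 hpm
    exact (List.nodup_range.filter _).filter _

end Summit.ValiantsHypothesis.ValiantsHypothesis.Theorems.TriangularDimersDivisionEasy.Negative
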